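import Summits.Ventures.HSemireg.Pad4TowerSeedB1
import Summits.Ventures.HSemireg.Pad4TowerFC1Mu4

/-!
# Venture HSemireg — PAD-4 on 𝔅(μ₄): LINE 4∕5 SEED (B1-D2S4) at ◇₈ for the WEAKER symmetry group `G′ = ⟨Δ²⟩ × S₄` with the FULL static bundle
# (RULE D + FC1 + X± + A2I±) — the K-free form of LINE 4's «G′ core_only UNSAT ×2» as a TYPED STATEMENT (no proof), and the PROVED corollary

HONEST FRAMING. Lean index of the computation cell `pub-hsemireg` (S4-PUSH, H2 door PAD-4), typed by the Ventures-side typer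
`hodge-lit-semireg-typer-2` (g6; line of record stmt-HodgeConjecture-18881 `Cruxes/BlochSeedDiscOne/Lines/birth.lean` 814a6a70c14e831a,
stub `stub_rung_pad4_seedAt`). Sequel of `Pad4TowerSeedB1` ((B1) at `G₁ = ⟨Δ⟩ × S₄`, `H₁`). WHAT THIS FILE IS: the statement file of LINE 4's attribution
variant **`core_only` on `G′ = ⟨Δ²⟩ × S₄`-orbit variables** (s4-search-1 g24, kit j305439 `W-SEARCH-D2S4-D8-v20`, encoder xres2s **v20** 76f384aebd0f8f81
= v19 c7ee80d7dccc0bfd + the d2s4 orbit kind, gs-eng-2 ×2 df6d536c39569499; variants line l.32692 (13:56:01Z)): on the ◇₈ `G′`-orbit pool (195 160 orbits; gates = Burnside ✓, self-check 0∕540, 0 unservable): `core_only` = STATIC + FC-CORE **UNSAT ×2** — 24 494 820 variables ∕ 119 054 866 clauses, kissat UNSAT 1 341 s + cadical UNSAT 1 366 s (the job then ended at its 4 h cap, 13:55:51Z; log `code∕g24∕harvest∕j305439-W-SEARCH-D2S4-D8-stdout-final-timeout.log` b27dd3a91aeb9f7e). Director-hodge g14 **R14.11** (l.32683):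
OPTION (α) — «faithfulness beats economy — a typed seed states EXACTLY what the machine certified, never a stronger static hypothesis than the run
used»: the G′ run kept ALL static families ON (plain `ALLV['core_only']`, `with_fc1=True`; no family deletion on G′), so the hypothesis bundle here is
**`StaticAll := RuleDMu4Closed ∧ FC1Mu4Closed ∧ XresFourClosed`** — FC1 APPEARS BECAUSE THE G′ RUN KEPT ALL STATIC FAMILIES ON; at `G₁` FC1 ∉ H₁ ∪ H_odd
∪ H₂ (famcore j305149); dropping FC1 at G′ would need a G′ famcore run — not scheduled. STATUS WORDS: `SeedB1Diamond8D2S4All` is a TYPED STATEMENT in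
HYPOTHESIS FORM — machine ×2 at INSTANCE level, NO proof; NOT asserted, no `axiom`, no `sorry`; not a Literature fact; nothing here is an object or a
census row. LINE 4's headline variant `full18` (STATIC + Ψ + Λ + FC-CORE) UNSAT ×2 (24 494 832 ∕ 120 155 038; kissat 997 s + cadical 1 408 s, l.32574) is
SUBSUMED by `core_only` for typing purposes (fewer presence blocks, same static side);  `full` = STATIC + Ψ on `G′` is UNDECIDED (kissat 63 min without a verdict when the cap struck) and the (CUL-8) rider `nocul` was NOT RUN — so NO (B2) and NO (CUL-8) statement for `G′` is typed here (R14.11: a `nocul` UNSAT ×2 would be booked in this docstring as a remark only).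

THE TWO SIDES, LITERALLY. Support: two finite levels in ◇₈ (`InDiamond 8`), each `G′`-CLOSED: **`MConfig.D2S4Closed`** := `PermClosed` ((G)) and
`D2Closed` ((I) `Pad4TowerDelta2Window`: closed under `Δ²`, `β ↦ −β`) on both levels — the supports expressible in the encoder's `d2s4` orbit variables;
`G1Closed → D2S4Closed` ((I) `DeltaClosed.d2Closed`), so the G′ seed COVERS every `G₁`-closed support (rows W14 Δ, W14c (2)(3), W14d of the card —
LINE 4's reading with (I)'s dominance `MConfig.wch_eq_zero_of_cleanInvariant`) and says nothing new there beyond (B1). HYPOTHESIS `StaticAll C`: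
`RuleDMu4Closed C` (FLAG R-1 as in (S)) ∧ `FC1Mu4Closed C` (`Pad4TowerFC1Mu4`, the encoder's `fc1_generic`, Q₀ at level P) ∧ `XresFourClosed C` ((R):
X−, X+, A2I−, A2I+). CONCLUSION `¬ FCCoreBlock C` ((S); the encoder's FC-CORE block, identical in v20). FLAG H-1 of (R) reads here with `G′`-orbit
representatives (the v20 heads) — same covariance remark, not a theorem.

CONTENT. §1 `MConfig.D2S4Closed`, `MConfig.d2S4Closed_of_g1Closed`, `MConfig.StaticAll`, `staticFour_of_staticAll`, `staticH1_of_staticAll`.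
§2 **`SeedB1Diamond8D2S4All : Prop`** (typed statement) and `seedB1G1All_of_D2S4All` (its restriction to `G₁`-closed supports). §3 PROVED COROLLARY
**`wch_eWord_eq_zero_of_seedB1D2S4`**: granted the seed, every multiplicity vector positive on a `G′`-closed fully-static two-level support in ◇₈ passing
(A1) has `μ = 0`. §4 probes (`decide`): `D2S4Closed` vs `G1Closed` on a Δ²-closed but not Δ-closed toy support.

WHAT IS NOT HERE ∕ NOT IN LEAN. No proof; no G′ famcore (FC1 stays in the bundle); no ◇₁₀ (j308425 pending); no Ψ∕Λ blocks of `full18` (subsumed).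
NOTHING HERE SAYS THAT HC ∕ HC_CM ∕ HC_AV ∕ W₆ ∕ HC_Kum4Type HOLDS OR FAILS; typed ≠ proved ≠ endorsed. No `instance`, no notation, no Literature fact,
0 `sorry`; axioms standard.

SOURCES (sha16 ∕ bus): s4-search-1 g24 LINE 4 VERDICT l.32574 + variants line variants line l.32692 (13:56:01Z); bc5-plan g7 LINE 4 pickup l.32589; director-hodge g13 R13.43,
R13.68, R13.71 (4), director-hodge g14 R14.11 l.32683; xres2s v20 76f384aebd0f8f81 (d2s4 DIFFs 4562d6a1be1ffd25 ∕ 0bbcf85b2e4bd1ba ∕ 00d7ec7b448a5a0b,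
g52 ×2 l.32428); `Pad4TowerSeedB1.lean` ea64aeb64d3b5f58, `Pad4TowerFC1Mu4.lean` 75aa825aa08efe25 (g5), `Pad4TowerXresFamilies.lean` dfe53b949d77d3f7,
`Pad4TowerDelta2Window.lean` ((I), `D2Closed`, `DeltaClosed.d2Closed`), `Pad4TowerPermWindow.lean` ((G)). -/

namespace Summit.Ventures.HSemireg.Pad4Tower

open Finset

/-! ## §1 `G′`-closed supports and the full static bundle -/

/-- both levels closed under the factor permutations `S₄` and under `Δ²` (`β ↦ −β` on every factor): the `G′ = ⟨Δ²⟩ × S₄`-CLOSED supports = the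
supports expressible in the encoder's `d2s4` orbit variables (LINE 4). Decidable. -/
abbrev MConfig.D2S4Closed (C : MConfig) : Prop :=
  PermClosed C.lower ∧ PermClosed C.upper ∧ D2Closed C.lower ∧ D2Closed C.upper

/-- a `G₁`-closed support is `G′`-closed (`Δ`-closed ⇒ `Δ²`-closed, (I) `DeltaClosed.d2Closed`). -/
theorem MConfig.d2S4Closed_of_g1Closed {C : MConfig} (h : C.G1Closed) : C.D2S4Closed :=
  ⟨h.1, h.2.1, DeltaClosed.d2Closed h.2.2.1, DeltaClosed.d2Closed h.2.2.2⟩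

/-- **the FULL static bundle** of the plain `core_only` variant (`with_x=True`, `with_fc1=True`): RULE-D closure, FC1, and all four instance families.
Decidable. -/
abbrev MConfig.StaticAll (C : MConfig) : Prop := RuleDMu4Closed C ∧ FC1Mu4Closed C ∧ XresFourClosed C

/-- the full bundle contains the four-family bundle … -/
theorem MConfig.staticFour_of_staticAll {C : MConfig} (h : C.StaticAll) : C.StaticFour := ⟨h.1, h.2.2⟩

/-- … and hence `H₁`. -/
theorem MConfig.staticH1_of_staticAll {C : MConfig} (h : C.StaticAll) : C.StaticH1 :=
  MConfig.staticH1_of_staticFour (MConfig.staticFour_of_staticAll h)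

/-! ## §2 The seed (B1-D2S4) — TYPED STATEMENT, machine ×2 at instance level (LINE 4 `core_only` on G′), NO proof -/

/-- **SEED (B1-D2S4) at ◇₈, `G′ = ⟨Δ²⟩ × S₄`, full static bundle**: for every two-level configuration of 𝔅(μ₄) cells inside ◇₈ whose levels are each
`G′`-closed, the full static bundle (RULE D ∧ FC1 ∧ X− ∧ X+ ∧ A2I− ∧ A2I+) excludes the FC-CORE presence block. EVIDENCE (instance level, not a proof):
kit j305439 variant `core_only` on `G′`-orbit variables — on the ◇₈ `G′`-orbit pool (195 160 orbits; gates = Burnside ✓, self-check 0∕540, 0 unservable): `core_only` = STATIC + FC-CORE **UNSAT ×2** — 24 494 820 variables ∕ 119 054 866 clauses, kissat UNSAT 1 341 s + cadical UNSAT 1 366 s (the job then ended at its 4 h cap, 13:55:51Z; log `code∕g24∕harvest∕j305439-W-SEARCH-D2S4-D8-stdout-final-timeout.log` b27dd3a91aeb9f7e). A HYPOTHESIS-FORM DEF: NOT asserted, no `axiom`, no `sorry`; TYPED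
STATEMENT ONLY. -/
def SeedB1Diamond8D2S4All : Prop :=
  ∀ C : MConfig, C.InDiamond 8 → C.D2S4Closed → C.StaticAll → ¬ C.FCCoreBlock

/-- restricted to `G₁`-closed supports the G′ seed gives the fully-static `G₁` statement (weaker than (B1), whose bundle is `H₁` only). -/
theorem seedB1G1All_of_D2S4All (h : SeedB1Diamond8D2S4All) :
    ∀ C : MConfig, C.InDiamond 8 → C.G1Closed → C.StaticAll → ¬ C.FCCoreBlock :=
  fun C hU hG hS => h C hU (MConfig.d2S4Closed_of_g1Closed hG) hS

/-! ## §3 The corollary (PROVED modulo the seed) -/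

/-- **COROLLARY OF (B1-D2S4), GRANTED THE SEED.** On every `G′`-closed fully-static two-level support in ◇₈, every multiplicity vector positive on the
support whose weighted class tensor passes (A1) has `μ = wch(eeee) = 0`. [(S) `fcCoreBlock_of_classScreen` + `axisCell_of_inDiamond`.] -/
theorem wch_eWord_eq_zero_of_seedB1D2S4 (hseed : SeedB1Diamond8D2S4All) (C : MConfig) (hU : C.InDiamond 8) (hG : C.D2S4Closed)
    (hS : C.StaticAll) (mN mP : MCell → ℤ) (hmN : ∀ Z ∈ C.lower, 0 < mN Z) (hmP : ∀ P ∈ C.upper, 0 < mP P)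
    (hA : ClassScreen (C.wch mN mP)) : C.wch mN mP eWord = 0 := by
  by_contra hμ
  obtain ⟨hN, hP⟩ := MConfig.axisCell_of_inDiamond hU
  exact hseed C hU hG hS (C.fcCoreBlock_of_classScreen mN mP hN hP hmN hmP hA hμ)

/-! ## §4 Probes (`decide`) -/

section Probes

/-- a Δ²-closed but NOT Δ-closed level: the `S₄ × Δ²`-orbit of `[ℓ₁]⁴` = `{[ℓ₁]⁴, [ℓ₋₁]⁴}` (the phase-`i` mates missing). -/
def d2Pair : MConfig := ⟨{mcellOf (lpt 1 0) (lpt 1 0) (lpt 1 0) (lpt 1 0), mcellOf (lpt 1 2) (lpt 1 2) (lpt 1 2) (lpt 1 2)}, ∅⟩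

set_option synthInstance.maxSize 8192 in
set_option synthInstance.maxHeartbeats 2000000 in -- large decidable instances, as in the family files
/-- `d2Pair` is `G′`-closed and in ◇₈ but NOT `G₁`-closed; `diagFour` is both. [kernel, `decide`] -/
theorem d2S4_probe : d2Pair.InDiamond 8 ∧ d2Pair.D2S4Closed ∧ ¬ d2Pair.G1Closed ∧ diagFour.D2S4Closed := by
  refine ⟨?_, ?_, ?_, ?_⟩ <;> decide +kernel

end Probes

end Summit.Ventures.HSemireg.Pad4Tower
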